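/-
Copyright (c) 2026 the pub-hodgecm-mathlib formalisation cell (harness21).  Prover seat hodgecm-mathlib-LH4-p07 (g9), req620 Track A «(D-RAM) FOUR-FRAME» squad
(STAGE-1b, row-(2) lineage; dealer LH4-plan (g13) WORD #94 (1) ∕ #97 ∕ #107 ∕ #109: the RamM LEVEL SOCKET), 2026-09-04.
-/
import Summits.HodgeConjecture.HodgeConjecture.Theorems.F0P3cDyRamOrderCountCensusRamM            -- ★ (C) `orderCountCensusC` (all its organs come with it)
import Summits.HodgeConjecture.HodgeConjecture.Theorems.F0P3cDyRamLevelsSocketTokensRamM           -- ★ p860582 (this seat): `levelTokens_near_one_ramM`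
import Summits.HodgeConjecture.HodgeConjecture.Theorems.F0P3cDyRamLevelsCensusCutoffCMRamMAtUnif    -- ★ p860955 (this seat): even-kν CM-place cutoff form
import Summits.HodgeConjecture.HodgeConjecture.Theorems.F0P3cDyRamLevelsCensusCutoffCMRamMOddAtUnif -- ★ p860956 (this seat): odd-kν CM-place cutoff form
import Summits.HodgeConjecture.HodgeConjecture.Theorems.F0P3cDyRamToricLevelCensusRamMOddDepth      -- ★ p860697 (LH4-p08 (g9)): `v_sub_map_eq_of_v_odd_ramified`
import Summits.HodgeConjecture.HodgeConjecture.Theorems.F0P3cDyRamLevelsSocketPrelude               -- ★ p860127 (this seat): `levels_bottom_arith`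
import Summits.HodgeConjecture.HodgeConjecture.Theorems.F0P3cDyRamLevelsLawRamM                      -- (this seat): `law_ramM_std`, `law_ramM_flip`
import Summits.HodgeConjecture.HodgeConjecture.Theorems.F0P3cDyRamLevelOrderCountsRamMWeldCutOfFrame -- ★ (LH4-p06 (g7), (R3′)): `levelOrderCounts_ramM_weld_cut_of_frame[_flip]`
import Summits.HodgeConjecture.HodgeConjecture.Theorems.F0P3cDyRamConeWeightHalfSplitMultiplier     -- ★ p859752: (β′) `finsum_levelSetDep_weight_eq_pow_mul_ncard_inv_mul`, `levelSetDep_subset_of_eq_mul`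
import Summits.HodgeConjecture.HodgeConjecture.Theorems.F0P3cDyRamConeWeightHalfSplit               -- ★ p857697: `exists_flipUnit_of_forall_fixed_fixed_isNorm`
import Summits.HodgeConjecture.HodgeConjecture.Theorems.F0P3cDyRamFourFrameCensusDefs               -- ★ `LatticeInLevel`
import Literature.NumberTheory.Rogawski1990.FinExplicitTransferFactorDeepTauUniform                  -- ★ `eventually_nhds_one_valued_sub_one_le`
import HarnessLib

/-!
# Crux `H413`, line LH4 «(D-RAM) FOUR-FRAME» — STAGE-1b, row (2): (SOCKET-C-lev) «THE LEVEL-CENSUS SOCKET ON TYPE RamM» — `levelsCensusC`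
Cell `hodgecm-mathlib` (D-0151), FLOOR 0, crux item H413 = `stmt-HodgeConjecture-24833`, route `HCCMUnconditional`; squad F0∕P3c∕LH4; lane `--supports stmt-HodgeConjecture-24833
--as helper` (count-neutral).  THE `hC` INPUT of ★ p860426 `levelsCensus2_of_types`: statement = ★ (C) `orderCountCensusC`'s binders VERBATIM + the piece parameters `(a b ks T)
(had) (hab1) (hks) (hT0) (hT1)` (SIG 7d4a4a70); conclusion (i) the norm clause, (ii) the two-literal level census in ★ p859606's `hLaw` currency.  PROOF = ★ (C)'s proof with
`V` shrunk by the near-1 letters, then the LEVEL BLOCK: ★ p860582 tokens → parity of `kν` (even: ★ p860955, guard = cutoff by `guard_even_iff_cutoff` and the integrality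
`k2 ≤ jλ`; odd: ★ p860956 with `kν = 2jλ + 1` by ★ p860697's rigidity) → (β′) ★ p859752 (cutoff `C = m + jλ − b`) → cells ⊆ unit cells → ★ (R3′) weld of the frame
(lane by `a % 2`) → ★ `law_ramM_*` → ★ `levels_bottom_arith`.  RamM organs: LH4-p08 (g9) (R0)(R1)(R2)(R5a∕b), LH4-p06 (g7) (R3)(R3′), LH4-p04 (cut tables), this seat.
HONEST LABEL.  Count-neutral; `HC_CM` is proved only modulo the 7 printed citations (2 remaining named inputs: hLiu418 = `stmt-HodgeConjecture-24832`, h413 =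
`stmt-HodgeConjecture-24833`) until rung 0 closes.  References: [Rogawski1990] §4.9 pp. 54–56, §12.2; [Kottwitz1986BaseChangeUnits] §1 pp. 240–241; [Jacobowitz1962] §4.
-/
set_option autoImplicit false
noncomputable section
namespace Summit.HodgeConjecture.HodgeConjecture.Cruxes.H413.F0P3cDyRamLevelsCensusRamM

open MeasureTheory Measure NumberField IsDedekindDomain Topology Filter
open Literature.NumberTheory.Automorphic Literature.NumberTheory.Automorphic.UnitaryGroup Literature.NumberTheory.Automorphic.IntegralReduction
open Literature.NumberTheory.Rogawski1990 Literature.NumberTheory.GaloisRepresentations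
open Literature.NumberTheory.Automorphic.UnitaryThreeFourFrame
open scoped Matrix MatrixGroups Classical Valued
open Literature.NumberTheory.Automorphic.UnitaryLatticeTree Literature.NumberTheory.Automorphic.HermitianLattice
open Literature.NumberTheory.QuadraticForms
open F0P3cDyRamToricCensusDefs F0P3cDyRamFrameRamMAtUniformiser F0P3cDyRamFrameRamMLetters F0P3cDyRamTokenDepthNearOne F0P3cDyRamTypeTwoBlockCongruenceNhds
  F0P3cDyRamTypeTwoTubeLetters F0P3cDyRamUniformizerPowerTube F0P3cDyRamToricLevelCensusRamM F0P3cDyRamToricLevelCensusRamMAtThirdField F0P3cDyRamOrderFiltrationRange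
  F0P3cDyRamCensusBottomArith F0P3cDyRamTypeTwoAnisotropyOfFrame F0P3cDyRamTypeUBottomFacts F0P3cDyRamTokenBridgeCM F0P3cDyRamTokenLettersRamM F0P3cDyRamTokenRealizabilityRamM
  F0P3cDyRamOrderCountCellsBound F0P3cDyRamHSideClosedFormRamM
open F0P3cDyRamFourFrameCensusDefs (LatticeInLevel)
open F0P3cDyRamLevelsSocketTokensRamM F0P3cDyRamLevelsCensusCutoffCMRamMAtUnif F0P3cDyRamLevelsCensusCutoffCMRamMOddAtUnif F0P3cDyRamLevelsSocketPrelude F0P3cDyRamLevelsLawRamM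
  F0P3cDyRamLevelOrderCountsRamMWeldCutOfFrame F0P3cDyRamConeWeightHalfSplitMultiplier F0P3cDyRamConeWeightHalfSplit
open F0P3cDyRamToricLevelCensusRamMOddDepth (v_sub_map_eq_of_v_odd_ramified)

/-- The even-trace-level guard of ★ p860955 is the cutoff `C = m + jλ − b` (pure arithmetic; `k2 ≤ jλ` is the integrality of the unit `ν∕ϖE^{k2}`). -/
theorem guard_even_iff_cutoff {j b' m b k2 kν jl C : ℕ} (hk : kν = 2 * k2) (hC : C = m + jl - b) (hbm : b ≤ m) (hk2 : k2 ≤ jl) :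
    (j + b' ≤ m - b + k2 ∨ 2 * (j + b') + kν ≤ 2 * (m - b + k2) + 2 * jl) ↔ j + b' ≤ C := by subst hk hC; omega

set_option maxHeartbeats 4000000 in -- statement-heavy socket head + 300-line proof (as ★ p860440 socket (B-lev))
/-- **(SOCKET-C-lev) THE LEVEL CENSUS ON TYPE RamM** — the `hC` binder of ★ p860426 `levelsCensus2_of_types` VERBATIM: ★ (C)'s binder list + the piece parameters;
(i) the norm clause `hFN` of the frame, (ii) the two-literal level census in ★ p859606's `hLaw` currency.  See the module docstring for the proof map.
[cite: Rogawski1990, §4.9 pp. 54–56] [cite: Kottwitz1986BaseChangeUnits, §1 pp. 240–241] [cite: Jacobowitz1962, §4] -/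
theorem levelsCensusC (L : Type) [Field L] [NumberField L] [IsCMField L]
    {v : HeightOneSpectrum (𝓞 ↥(maximalRealSubfield L))} (w : UnitaryGroup.PlacesOver L v)
    (hw : IsCMField.complexConj L • w.1 = w.1) (he : v.asIdeal.ramificationIdx' w.1.asIdeal ≠ 1)
    (ϖ : (w.1.adicCompletion L)) (hϖ : Valued.v ϖ = WithZero.exp (-1 : ℤ)) (d tE : ℕ)
    (hD : IsRamifiedQuadraticDatum (galAdicCompletionMap (L := L) (IsCMField.complexConj L) hw) ϖ d tE)
    (h2v : Valued.v (2 : (w.1.adicCompletion L)) < 1)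
    [Fintype (Valued.ResidueField (w.1.adicCompletion L))]
    (a b ks T : ℕ) (had : a ≤ d) (hab1 : d + 2 * a ≤ b + 1)
    (hks : 2 * ks + 2 * ((d + a % 2) / 2) = a + a % 2 + (b + b % 2))
    (hT0 : a % 2 = 0 → T + a = ks + (d - d % 2)) (hT1 : a % 2 = 1 → T + a + 1 = ks + (d - d % 2) + 2 * (d % 2)) :
      ∃ V ∈ 𝓝 (1 : ((UnitaryGroup.cmDatum L 2 (Matrix.of fun i j : Fin 2 => if i.val + j.val + 1 = 2 then (1 : L) else 0)).Local v × (UnitaryGroup.cmDatum L 1 (Matrix.of fun i j : Fin 1 => if i.val + j.val + 1 = 1 then (1 : L) else 0)).Local v)), ∀ γH ∈ V, IsLocalGRegular L v γH → ¬ (∃ x : (w.1.adicCompletion L), (((((γH).1.val : GL (Fin 2) (UnitaryGroup.LocalRing L v)).val.map (Pi.evalRingHom (fun w' : UnitaryGroup.PlacesOver L v => w'.1.adicCompletion L) w))).charpoly).IsRoot x) → ∀ (E' : Type) [Field E'] [NumberField E'] [Algebra L E'] [Algebra.IsQuadraticExtension L E'] (c₁ : E' ≃ₐ[L] E') (δ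 : E') (m₀ : L) (s : (w.1.adicCompletion L)) (w₁ : UnitaryGroup.PlacesOver E' w.1) (hw₁ : c₁ • w₁.1 = w₁.1) (Θ : (w₁.1.adicCompletion E') →+* (w₁.1.adicCompletion E')) (α lam : (w₁.1.adicCompletion E')), c₁ ≠ 1 → c₁ δ = -δ → δ ≠ 0 → algebraMap L E' m₀ = δ ^ 2 → s ≠ 0 → (((γH.1.val : GL (Fin 2) (UnitaryGroup.LocalRing L v)).val.map (Pi.evalRingHom (fun w' : UnitaryGroup.PlacesOver L v => w'.1.adicCompletion L) w))).trace * (((γH.1.val : GL (Fin 2) (UnitaryGroup.LocalRing L v)).val.map (Pi.evalRingHom (fun w' : UnitaryGroup.PlacesOver L v => w'.1.adicCompletion L) w))).trace - 4 * (((γH.1.val : GL (Fin 2) (UnitaryGroup.LocalRing L v)).val.map (Pi.evalRingHom (fun w' : UnitaryGroup.PlacesOver L v => w'.1.adicCompletion L) w))).det = s * s * ((m₀ : L) : (w.1.adicCompletion L)) →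
      (((γH.1.val : GL (Fin 2) (UnitaryGroup.LocalRing L v)).val.map (Pi.evalRingHom (fun w' : UnitaryGroup.PlacesOver L v => w'.1.adicCompletion L) w))).det * (galAdicCompletionMap (L := L) (IsCMField.complexConj L) hw) (((γH.1.val : GL (Fin 2) (UnitaryGroup.LocalRing L v)).val.map (Pi.evalRingHom (fun w' : UnitaryGroup.PlacesOver L v => w'.1.adicCompletion L) w))).det = 1 → (((γH.1.val : GL (Fin 2) (UnitaryGroup.LocalRing L v)).val.map (Pi.evalRingHom (fun w' : UnitaryGroup.PlacesOver L v => w'.1.adicCompletion L) w))).trace = (((γH.1.val : GL (Fin 2) (UnitaryGroup.LocalRing L v)).val.map (Pi.evalRingHom (fun w' : UnitaryGroup.PlacesOver L v => w'.1.adicCompletion L) w))).det * (galAdicCompletionMap (L := L) (IsCMField.complexConj L) hw) (((γH.1.val : GL (Fin 2) (UnitaryGroup.LocalRing L v)).val.map (Pi.evalRingHom (fun w' : UnitaryGroup.PlacesOver L v => w'.1.adicCompletion L) w))).trace → (∀ x : (w.1.adicCompletion L), x * x - (((γH.1.val : GL (Fin 2) (UnitaryGroup.LocalRing L v)).val.map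 (Pi.evalRingHom (fun w' : UnitaryGroup.PlacesOver L v => w'.1.adicCompletion L) w))).trace * x + (((γH.1.val : GL (Fin 2) (UnitaryGroup.LocalRing L v)).val.map (Pi.evalRingHom (fun w' : UnitaryGroup.PlacesOver L v => w'.1.adicCompletion L) w))).det ≠ 0) → (∀ z, galAdicCompletionMap (L := E') c₁ hw₁ (galAdicCompletionMap (L := E') c₁ hw₁ z) = z) → (∀ z, Valued.v (galAdicCompletionMap (L := E') c₁ hw₁ z) = Valued.v z) → (∀ a, galAdicCompletionMap (L := E') c₁ hw₁ (toPlace w.1 w₁ a) = toPlace w.1 w₁ a) → (∀ a, Valued.v (toPlace w.1 w₁ a) ≤ 1 ↔ Valued.v a ≤ 1) → (∀ z : (w₁.1.adicCompletion E'), galAdicCompletionMap (L := E') c₁ hw₁ z = z ↔ ∃ a, toPlace w.1 w₁ a = z) → (∀ a, Θ (toPlace w.1 w₁ a) = toPlace w.1 w₁ ((galAdicCompletionMap (L := L) (IsCMField.complexConj L) hw) a)) → (∀ z, Θ (Θ z) = z) →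
      (∀ z, Θ (galAdicCompletionMap (L := E') c₁ hw₁ z) = galAdicCompletionMap (L := E') c₁ hw₁ (Θ z)) → (∀ z, Valued.v (Θ z) = Valued.v z) → galAdicCompletionMap (L := E') c₁ hw₁ α ≠ α → Valued.v α ≤ 1 → (∀ z : (w₁.1.adicCompletion E'), Valued.v z ≤ 1 → Valued.v ((z - galAdicCompletionMap (L := E') c₁ hw₁ z) / (α - galAdicCompletionMap (L := E') c₁ hw₁ α)) ≤ 1) → 2 * lam = toPlace w.1 w₁ (((γH.1.val : GL (Fin 2) (UnitaryGroup.LocalRing L v)).val.map (Pi.evalRingHom (fun w' : UnitaryGroup.PlacesOver L v => w'.1.adicCompletion L) w))).trace + toPlace w.1 w₁ s * ((δ : E') : (w₁.1.adicCompletion E')) → lam * lam = toPlace w.1 w₁ (((γH.1.val : GL (Fin 2) (UnitaryGroup.LocalRing L v)).val.map (Pi.evalRingHom (fun w' : UnitaryGroup.PlacesOver L v => w'.1.adicCompletion L) w))).trace * lam - toPlace w.1 w₁ (((γH.1.val : GL (Fin 2) (UnitaryGroup.LocalRing L v)).val.map (Pi.evalRingHom (fun w' : UnitaryGroup.PlacesOver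 L v => w'.1.adicCompletion L) w))).det → galAdicCompletionMap (L := E') c₁ hw₁ lam = toPlace w.1 w₁ (((γH.1.val : GL (Fin 2) (UnitaryGroup.LocalRing L v)).val.map (Pi.evalRingHom (fun w' : UnitaryGroup.PlacesOver L v => w'.1.adicCompletion L) w))).trace - lam → Θ lam * lam = 1 → Valued.v lam = 1 → (∀ z : (w₁.1.adicCompletion E'), ∃! pq : (w.1.adicCompletion L) × (w.1.adicCompletion L), z = toPlace w.1 w₁ pq.1 + toPlace w.1 w₁ pq.2 * lam) → Valued.v (α - (galAdicCompletionMap (L := E') c₁ hw₁) α) < 1 → ∀ (th ta : ((UnitaryGroup.cmDatum L 3 (Matrix.of fun i j : Fin 3 => if i.val + j.val + 1 = 3 then (1 : L) else 0)).Local v)) (P₁ : GL (Fin 3) (w.1.adicCompletion L)) (dg : Fin 2 → (w.1.adicCompletion L)) (η : (w.1.adicCompletion L)) (γ₁ : GL (Fin 2) (w.1.adicCompletion L)),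
      ((localNonsplitEquiv (IsCMField.complexConj L) (Matrix.of fun i j : Fin 3 => if i.val + j.val + 1 = 3 then (1 : L) else 0) (IsCMField.complexConj_ne_one L) w hw th : ↥(unitaryGroupOfForm (galAdicCompletionMap (L := L) (IsCMField.complexConj L) hw) (placeForm (Matrix.of fun i j : Fin 3 => if i.val + j.val + 1 = 3 then (1 : L) else 0) w.1))) : GL (Fin 3) (w.1.adicCompletion L)) = endoGL (((localNonsplitEquiv (IsCMField.complexConj L) (Matrix.of fun i j : Fin 2 => if i.val + j.val + 1 = 2 then (1 : L) else 0) (IsCMField.complexConj_ne_one L) w hw γH.1 : ↥(unitaryGroupOfForm (galAdicCompletionMap (L := L) (IsCMField.complexConj L) hw) (placeForm (Matrix.of fun i j : Fin 2 => if i.val + j.val + 1 = 2 then (1 : L) else 0) w.1))) : GL (Fin 2) (w.1.adicCompletion L)), ((localNonsplitEquiv (IsCMField.complexConj L) (Matrix.of fun i j : Fin 1 => if i.val + j.val + 1 = 1 then (1 : L) else 0) (IsCMField.complexConj_ne_one L) w hw γH.2).val : GL (Fin 1) (w.1.adicCompletion L))) → ((localNonsplitEquiv (IsCMField.complexConj L)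 (Matrix.of fun i j : Fin 3 => if i.val + j.val + 1 = 3 then (1 : L) else 0) (IsCMField.complexConj_ne_one L) w hw ta : ↥(unitaryGroupOfForm (galAdicCompletionMap (L := L) (IsCMField.complexConj L) hw) (placeForm (Matrix.of fun i j : Fin 3 => if i.val + j.val + 1 = 3 then (1 : L) else 0) w.1))) : GL (Fin 3) (w.1.adicCompletion L)) = P₁ * endoGL (γ₁, ((localNonsplitEquiv (IsCMField.complexConj L) (Matrix.of fun i j : Fin 1 => if i.val + j.val + 1 = 1 then (1 : L) else 0) (IsCMField.complexConj_ne_one L) w hw γH.2).val : GL (Fin 1) (w.1.adicCompletion L))) * P₁⁻¹ →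
      formCongr (galAdicCompletionMap (L := L) (IsCMField.complexConj L) hw) P₁ (placeForm (Matrix.of fun i j : Fin 3 => if i.val + j.val + 1 = 3 then (1 : L) else 0) w.1) = (!![(Matrix.diagonal dg) 0 0, 0, (Matrix.diagonal dg) 0 1; 0, η, 0; (Matrix.diagonal dg) 1 0, 0, (Matrix.diagonal dg) 1 1] : Matrix (Fin 3) (Fin 3) (w.1.adicCompletion L)) → (∀ i, Valued.v (dg i) = 1) → (∀ i, (galAdicCompletionMap (L := L) (IsCMField.complexConj L) hw) (dg i) = dg i) → (galAdicCompletionMap (L := L) (IsCMField.complexConj L) hw) η = η → Valued.v η = 1 → (¬ ∃ t : (w.1.adicCompletion L), t * (galAdicCompletionMap (L := L) (IsCMField.complexConj L) hw) t = η) → γ₁ ∈ unitaryGroupOfForm (galAdicCompletionMap (L := L) (IsCMField.complexConj L) hw) (Matrix.diagonal dg) → (γ₁ : Matrix (Fin 2) (Fin 2) (w.1.adicCompletion L)).charpoly = (((γH.1.val : GL (Fin 2) (UnitaryGroup.LocalRing L v)).val.map (Pi.evalRingHom (fun w' : UnitaryGroup.PlacesOver L v => w'.1.adicCompletion L) w))).charpoly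 → ∀ (φ : (Fin 2 → (w.1.adicCompletion L)) →+ (w₁.1.adicCompletion E')) (h : (w₁.1.adicCompletion E')) (φ' : (Fin 2 → (w.1.adicCompletion L)) →+ (w₁.1.adicCompletion E')) (h' : (w₁.1.adicCompletion E')), (∀ (c : (w.1.adicCompletion L)) (x : Fin 2 → (w.1.adicCompletion L)), φ (c • x) = toPlace w.1 w₁ c * φ x) → Function.Injective φ → Function.Surjective φ → (∀ x, φ ((((localNonsplitEquiv (IsCMField.complexConj L) (Matrix.of fun i j : Fin 2 => if i.val + j.val + 1 = 2 then (1 : L) else 0) (IsCMField.complexConj_ne_one L) w hw γH.1 : ↥(unitaryGroupOfForm (galAdicCompletionMap (L := L) (IsCMField.complexConj L) hw) (placeForm (Matrix.of fun i j : Fin 2 => if i.val + j.val + 1 = 2 then (1 : L) else 0) w.1))) : GL (Fin 2) (w.1.adicCompletion L)) : Matrix (Fin 2) (Fin 2) (w.1.adicCompletion L)).mulVec x) = lam * φ x) →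
      (∀ x y, toPlace w.1 w₁ (pairing (galAdicCompletionMap (L := L) (IsCMField.complexConj L) hw) (placeForm (Matrix.of fun i j : Fin 2 => if i.val + j.val + 1 = 2 then (1 : L) else 0) w.1) x y) = h * Θ (φ x) * φ y + galAdicCompletionMap (L := E') c₁ hw₁ (h * Θ (φ x) * φ y)) → Θ h = h → h ≠ 0 → (∃ x : (w₁.1.adicCompletion E'), x ≠ 0 ∧ h * Θ x * x + galAdicCompletionMap (L := E') c₁ hw₁ (h * Θ x * x) = 0) → (∀ (c : (w.1.adicCompletion L)) (x : Fin 2 → (w.1.adicCompletion L)), φ' (c • x) = toPlace w.1 w₁ c * φ' x) → Function.Injective φ' → Function.Surjective φ' → (∀ x, φ' ((γ₁ : Matrix (Fin 2) (Fin 2) (w.1.adicCompletion L)).mulVec x) = lam * φ' x) → (∀ x y, toPlace w.1 w₁ (pairing (galAdicCompletionMap (L := L) (IsCMField.complexConj L) hw) (Matrix.diagonal dg) x y) = h' * Θ (φ' x) * φ' y + galAdicCompletionMap (L := E') c₁ hw₁ (h' * Θ (φ' x) * φ' y)) → Θ h' = h' → h' ≠ 0 → (∀ (t : (w.1.adicCompletion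 L)) (n : ℤ), Valued.v (toPlace w.1 w₁ t) = Valued.v (toPlace w.1 w₁ ϖ) ^ n ↔ Valued.v t = Valued.v ϖ ^ n) → (∀ c : (w₁.1.adicCompletion E'), galAdicCompletionMap (L := E') c₁ hw₁ c = c → c ≠ 0 → Valued.v c ≤ 1 → ∃ n : ℕ, Valued.v c = Valued.v (toPlace w.1 w₁ ϖ) ^ n) → (∀ t : (w₁.1.adicCompletion E'), galAdicCompletionMap (L := E') c₁ hw₁ t = t → Valued.v t < 1 → Valued.v t ≤ Valued.v (toPlace w.1 w₁ ϖ)) → ∀ (J R R' : ℕ) (f f' : ℕ → ℕ → AddSubgroup (w₁.1.adicCompletion E') → ℕ),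
      {M₃ : Submodule (Valued.integer (w.1.adicCompletion L)) (Fin 3 → (w.1.adicCompletion L)) | IsVertexLattice (galAdicCompletionMap (L := L) (IsCMField.complexConj L) hw) ϖ ((StdForm.antidiagonal 3).over (w.1.adicCompletion L)) 0 M₃ ∧ mapGL (endoGL (((localNonsplitEquiv (IsCMField.complexConj L) (Matrix.of fun i j : Fin 2 => if i.val + j.val + 1 = 2 then (1 : L) else 0) (IsCMField.complexConj_ne_one L) w hw γH.1 : ↥(unitaryGroupOfForm (galAdicCompletionMap (L := L) (IsCMField.complexConj L) hw) (placeForm (Matrix.of fun i j : Fin 2 => if i.val + j.val + 1 = 2 then (1 : L) else 0) w.1))) : GL (Fin 2) (w.1.adicCompletion L)), ((localNonsplitEquiv (IsCMField.complexConj L) (Matrix.of fun i j : Fin 1 => if i.val + j.val + 1 = 1 then (1 : L) else 0) (IsCMField.complexConj_ne_one L) w hw γH.2).val : GL (Fin 1) (w.1.adicCompletion L)))) M₃ = M₃}.Finite → (∀ M₃ : Submodule (Valued.integer (w.1.adicCompletion L)) (Fin 3 → (w.1.adicCompletion L)), IsVertexLattice (galAdicCompletionMap (L := L) (IsCMField.complexConj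 L) hw) ϖ ((StdForm.antidiagonal 3).over (w.1.adicCompletion L)) 0 M₃ → mapGL (endoGL (((localNonsplitEquiv (IsCMField.complexConj L) (Matrix.of fun i j : Fin 2 => if i.val + j.val + 1 = 2 then (1 : L) else 0) (IsCMField.complexConj_ne_one L) w hw γH.1 : ↥(unitaryGroupOfForm (galAdicCompletionMap (L := L) (IsCMField.complexConj L) hw) (placeForm (Matrix.of fun i j : Fin 2 => if i.val + j.val + 1 = 2 then (1 : L) else 0) w.1))) : GL (Fin 2) (w.1.adicCompletion L)), ((localNonsplitEquiv (IsCMField.complexConj L) (Matrix.of fun i j : Fin 1 => if i.val + j.val + 1 = 1 then (1 : L) else 0) (IsCMField.complexConj_ne_one L) w hw γH.2).val : GL (Fin 1) (w.1.adicCompletion L)))) M₃ = M₃ → ∀ b : ℕ, (∀ c : (w.1.adicCompletion L), (Pi.single 1 c : Fin 3 → (w.1.adicCompletion L)) ∈ M₃ ↔ Valued.v c ≤ Valued.v ϖ ^ b) → b ≤ R) →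
      {M₃ : Submodule (Valued.integer (w.1.adicCompletion L)) (Fin 3 → (w.1.adicCompletion L)) | IsSelfDualLattice (galAdicCompletionMap (L := L) (IsCMField.complexConj L) hw) ϖ (!![(Matrix.diagonal dg) 0 0, 0, (Matrix.diagonal dg) 0 1; 0, η, 0; (Matrix.diagonal dg) 1 0, 0, (Matrix.diagonal dg) 1 1] : Matrix (Fin 3) (Fin 3) (w.1.adicCompletion L)) M₃ ∧ mapGL (endoGL (γ₁, ((localNonsplitEquiv (IsCMField.complexConj L) (Matrix.of fun i j : Fin 1 => if i.val + j.val + 1 = 1 then (1 : L) else 0) (IsCMField.complexConj_ne_one L) w hw γH.2).val : GL (Fin 1) (w.1.adicCompletion L)))) M₃ = M₃}.Finite → (∀ M₃ : Submodule (Valued.integer (w.1.adicCompletion L)) (Fin 3 → (w.1.adicCompletion L)), IsSelfDualLattice (galAdicCompletionMap (L := L) (IsCMField.complexConj L) hw) ϖ (!![(Matrix.diagonal dg) 0 0, 0, (Matrix.diagonal dg) 0 1; 0, η, 0; (Matrix.diagonal dg) 1 0, 0, (Matrix.diagonal dg) 1 1] : Matrix (Fin 3) (Fin 3) (w.1.adicCompletion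 L)) M₃ → mapGL (endoGL (γ₁, ((localNonsplitEquiv (IsCMField.complexConj L) (Matrix.of fun i j : Fin 1 => if i.val + j.val + 1 = 1 then (1 : L) else 0) (IsCMField.complexConj_ne_one L) w hw γH.2).val : GL (Fin 1) (w.1.adicCompletion L)))) M₃ = M₃ → ∀ b : ℕ, (∀ c : (w.1.adicCompletion L), (Pi.single 1 c : Fin 3 → (w.1.adicCompletion L)) ∈ M₃ ↔ Valued.v c ≤ Valued.v ϖ ^ b) → b ≤ R') → ¬ IsOrd (galAdicCompletionMap (L := E') c₁ hw₁) α (toPlace w.1 w₁ ϖ ^ (J + 1)) lam → (∀ j a, (levelSet (galAdicCompletionMap (L := E') c₁ hw₁) Θ α (toPlace w.1 w₁ ϖ) h j a).Finite) → (∀ j a, (levelSet (galAdicCompletionMap (L := E') c₁ hw₁) Θ α (toPlace w.1 w₁ ϖ) h' j a).Finite) → Valued.v ((((localNonsplitEquiv (IsCMField.complexConj L) (Matrix.of fun i j : Fin 1 => if i.val + j.val + 1 = 1 then (1 : L) else 0) (IsCMField.complexConj_ne_one L) w hw γH.2).val : GL (Fin 1) (w.1.adicCompletion L)) : Matrix (Fin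 1) (Fin 1) (w.1.adicCompletion L)) 0 0) = 1 →
      (∀ (b j : ℕ) (Λ : AddSubgroup (w₁.1.adicCompletion E')) (x₀ : (w₁.1.adicCompletion E')) (r : (w.1.adicCompletion L)), 1 ≤ b → x₀ ≠ 0 → (∀ x, x ∈ Λ ↔ ∃ z, IsOrd (galAdicCompletionMap (L := E') c₁ hw₁) α (toPlace w.1 w₁ ϖ ^ j) z ∧ x = x₀ * z) → IsOrd (galAdicCompletionMap (L := E') c₁ hw₁) α (toPlace w.1 w₁ ϖ ^ j) (dualGen (galAdicCompletionMap (L := E') c₁ hw₁) Θ α (toPlace w.1 w₁ ϖ ^ j) h x₀) → ¬ IsOrd (galAdicCompletionMap (L := E') c₁ hw₁) α (toPlace w.1 w₁ ϖ ^ j) (dualGen (galAdicCompletionMap (L := E') c₁ hw₁) Θ α (toPlace w.1 w₁ ϖ ^ j) h x₀ / toPlace w.1 w₁ ϖ) → Valued.v (dualGen (galAdicCompletionMap (L := E') c₁ hw₁) Θ α (toPlace w.1 w₁ ϖ ^ j) h x₀) = Valued.v (toPlace w.1 w₁ ϖ) ^ b → (∀ b', (∀ x ∈ Λ, Valued.v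 (h * Θ x * b' + galAdicCompletionMap (L := E') c₁ hw₁ (h * Θ x * b')) ≤ 1) → (lam - toPlace w.1 w₁ ((((localNonsplitEquiv (IsCMField.complexConj L) (Matrix.of fun i j : Fin 1 => if i.val + j.val + 1 = 1 then (1 : L) else 0) (IsCMField.complexConj_ne_one L) w hw γH.2).val : GL (Fin 1) (w.1.adicCompletion L)) : Matrix (Fin 1) (Fin 1) (w.1.adicCompletion L)) 0 0)) * b' ∈ Λ) → IsOrd (galAdicCompletionMap (L := E') c₁ hw₁) α (toPlace w.1 w₁ ϖ ^ j) lam → toPlace w.1 w₁ r = glueUnit (galAdicCompletionMap (L := E') c₁ hw₁) Θ α (toPlace w.1 w₁ ϖ ^ j) h (toPlace w.1 w₁ ϖ) (toPlace w.1 w₁ 1) x₀ b → f b j Λ = Nat.card {x : 𝒪[(w.1.adicCompletion L)] ⧸ 𝓂[(w.1.adicCompletion L)] ^ (2 * b) // ∃ u' : 𝒪[(w.1.adicCompletion L)], Ideal.Quotient.mk (𝓂[(w.1.adicCompletion L)] ^ (2 * b)) u' = x ∧ Valued.v ((u' : (w.1.adicCompletion L)) * (galAdicCompletionMap (L := L)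 (IsCMField.complexConj L) hw) u' - r) ≤ Valued.v (ϖ ^ (2 * b))}) → (∀ (b j : ℕ) (Λ : AddSubgroup (w₁.1.adicCompletion E')) (x₀ : (w₁.1.adicCompletion E')) (r : (w.1.adicCompletion L)), 1 ≤ b → x₀ ≠ 0 → (∀ x, x ∈ Λ ↔ ∃ z, IsOrd (galAdicCompletionMap (L := E') c₁ hw₁) α (toPlace w.1 w₁ ϖ ^ j) z ∧ x = x₀ * z) →
      IsOrd (galAdicCompletionMap (L := E') c₁ hw₁) α (toPlace w.1 w₁ ϖ ^ j) (dualGen (galAdicCompletionMap (L := E') c₁ hw₁) Θ α (toPlace w.1 w₁ ϖ ^ j) h' x₀) → ¬ IsOrd (galAdicCompletionMap (L := E') c₁ hw₁) α (toPlace w.1 w₁ ϖ ^ j) (dualGen (galAdicCompletionMap (L := E') c₁ hw₁) Θ α (toPlace w.1 w₁ ϖ ^ j) h' x₀ / toPlace w.1 w₁ ϖ) → Valued.v (dualGen (galAdicCompletionMap (L := E') c₁ hw₁) Θ α (toPlace w.1 w₁ ϖ ^ j) h' x₀) = Valued.v (toPlace w.1 w₁ ϖ) ^ b → (∀ b', (∀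 x ∈ Λ, Valued.v (h' * Θ x * b' + galAdicCompletionMap (L := E') c₁ hw₁ (h' * Θ x * b')) ≤ 1) → (lam - toPlace w.1 w₁ ((((localNonsplitEquiv (IsCMField.complexConj L) (Matrix.of fun i j : Fin 1 => if i.val + j.val + 1 = 1 then (1 : L) else 0) (IsCMField.complexConj_ne_one L) w hw γH.2).val : GL (Fin 1) (w.1.adicCompletion L)) : Matrix (Fin 1) (Fin 1) (w.1.adicCompletion L)) 0 0)) * b' ∈ Λ) → IsOrd (galAdicCompletionMap (L := E') c₁ hw₁) α (toPlace w.1 w₁ ϖ ^ j) lam → toPlace w.1 w₁ r = glueUnit (galAdicCompletionMap (L := E') c₁ hw₁) Θ α (toPlace w.1 w₁ ϖ ^ j) h' (toPlace w.1 w₁ ϖ) (toPlace w.1 w₁ η) x₀ b → f' b j Λ = Nat.card {x : 𝒪[(w.1.adicCompletion L)] ⧸ 𝓂[(w.1.adicCompletion L)] ^ (2 * b) // ∃ u' : 𝒪[(w.1.adicCompletion L)], Ideal.Quotient.mk (𝓂[(w.1.adicCompletion L)] ^ (2 * b)) u' = x ∧ Valued.v ((u' : (w.1.adicCompletion L)) *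 (galAdicCompletionMap (L := L) (IsCMField.complexConj L) hw) u' - r) ≤ Valued.v (ϖ ^ (2 * b))}) → (∀ f₀ : (w₁.1.adicCompletion E'), galAdicCompletionMap (L := E') c₁ hw₁ f₀ = f₀ → Θ f₀ = f₀ → Valued.v f₀ = 1 → ∃ z : (w₁.1.adicCompletion E'), z * Θ z = f₀) ∧ (∀ (m : ℕ) (β : (v.adicCompletion ↥(maximalRealSubfield L))ˣ), Valued.v (((finCharpolyTwo L v γH).eval (finGammaTwo L v γH)) w) = Valued.v ((toPlace v w (HeckeCharacter.uniformizer ↥(maximalRealSubfield L) v : v.adicCompletion ↥(maximalRealSubfield L))) ^ m) →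
      toPlace v w (β : (v.adicCompletion ↥(maximalRealSubfield L))) = -(((finCharpolyTwo L v γH).eval (finGammaTwo L v γH)) w * (finGammaTwo L v γH w ^ 2 + ((γH.1.val.val : Matrix (Fin 2) (Fin 2) (UnitaryGroup.LocalRing L v)).map (Pi.evalRingHom (fun w' : UnitaryGroup.PlacesOver L v => w'.1.adicCompletion L) w)).det)) / (2 * finGammaTwo L v γH w ^ 2 * ((γH.1.val.val : Matrix (Fin 2) (Fin 2) (UnitaryGroup.LocalRing L v)).map (Pi.evalRingHom (fun w' : UnitaryGroup.PlacesOver L v => w'.1.adicCompletion L) w)).det) → (((Fintype.card (Valued.ResidueField (w.1.adicCompletion L))) : ℤ) - 1) * ((Fintype.card (Valued.ResidueField (w.1.adicCompletion L))) : ℤ) ^ ks * ((({M : Submodule (Valued.integer (w.1.adicCompletion L)) (Fin 3 → w.1.adicCompletion L) | IsVertexLattice (galAdicCompletionMap (L := L) (IsCMField.complexConj L) hw) ϖ ((StdForm.antidiagonal 3).over (w.1.adicCompletion L)) 0 M ∧ mapGL ((localNonsplitEquiv (IsCMField.complexConj L) (Matrix.of fun i j : Fin 3 => if i.val + j.val +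 1 = 3 then (1 : L) else 0) (IsCMField.complexConj_ne_one L) w hw th : ↥(unitaryGroupOfForm (galAdicCompletionMap (L := L) (IsCMField.complexConj L) hw) (placeForm (Matrix.of fun i j : Fin 3 => if i.val + j.val + 1 = 3 then (1 : L) else 0) w.1))) : GL (Fin 3) (w.1.adicCompletion L)) M = M ∧ (LatticeInLevel ϖ a ((((localNonsplitEquiv (IsCMField.complexConj L) (Matrix.of fun i j : Fin 3 => if i.val + j.val + 1 = 3 then (1 : L) else 0) (IsCMField.complexConj_ne_one L) w hw th : ↥(unitaryGroupOfForm (galAdicCompletionMap (L := L) (IsCMField.complexConj L) hw) (placeForm (Matrix.of fun i j : Fin 3 => if i.val + j.val + 1 = 3 then (1 : L) else 0) w.1))) : GL (Fin 3) (w.1.adicCompletion L)) : Matrix (Fin 3) (Fin 3) (w.1.adicCompletion L)) - 1) M ∧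
      LatticeInLevel ϖ b (((((localNonsplitEquiv (IsCMField.complexConj L) (Matrix.of fun i j : Fin 3 => if i.val + j.val + 1 = 3 then (1 : L) else 0) (IsCMField.complexConj_ne_one L) w hw th : ↥(unitaryGroupOfForm (galAdicCompletionMap (L := L) (IsCMField.complexConj L) hw) (placeForm (Matrix.of fun i j : Fin 3 => if i.val + j.val + 1 = 3 then (1 : L) else 0) w.1))) : GL (Fin 3) (w.1.adicCompletion L)) : Matrix (Fin 3) (Fin 3) (w.1.adicCompletion L)) - 1) * ((((localNonsplitEquiv (IsCMField.complexConj L) (Matrix.of fun i j : Fin 3 => if i.val + j.val + 1 = 3 then (1 : L) else 0) (IsCMField.complexConj_ne_one L) w hw th : ↥(unitaryGroupOfForm (galAdicCompletionMap (L := L) (IsCMField.complexConj L) hw) (placeForm (Matrix.of fun i j : Fin 3 => if i.val + j.val + 1 = 3 then (1 : L) else 0) w.1))) : GL (Fin 3) (w.1.adicCompletion L)) : Matrix (Fin 3) (Fin 3) (w.1.adicCompletion L)) - 1)) M)}.ncard : ℕ) : ℤ) - (({M : Submodule (Valued.integer (w.1.adicCompletion L)) (Fin 3 → w.1.adicCompletion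 L) | IsVertexLattice (galAdicCompletionMap (L := L) (IsCMField.complexConj L) hw) ϖ ((StdForm.antidiagonal 3).over (w.1.adicCompletion L)) 0 M ∧ mapGL ((localNonsplitEquiv (IsCMField.complexConj L) (Matrix.of fun i j : Fin 3 => if i.val + j.val + 1 = 3 then (1 : L) else 0) (IsCMField.complexConj_ne_one L) w hw ta : ↥(unitaryGroupOfForm (galAdicCompletionMap (L := L) (IsCMField.complexConj L) hw) (placeForm (Matrix.of fun i j : Fin 3 => if i.val + j.val + 1 = 3 then (1 : L) else 0) w.1))) : GL (Fin 3) (w.1.adicCompletion L)) M = M ∧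
      (LatticeInLevel ϖ a ((((localNonsplitEquiv (IsCMField.complexConj L) (Matrix.of fun i j : Fin 3 => if i.val + j.val + 1 = 3 then (1 : L) else 0) (IsCMField.complexConj_ne_one L) w hw ta : ↥(unitaryGroupOfForm (galAdicCompletionMap (L := L) (IsCMField.complexConj L) hw) (placeForm (Matrix.of fun i j : Fin 3 => if i.val + j.val + 1 = 3 then (1 : L) else 0) w.1))) : GL (Fin 3) (w.1.adicCompletion L)) : Matrix (Fin 3) (Fin 3) (w.1.adicCompletion L)) - 1) M ∧ LatticeInLevel ϖ b (((((localNonsplitEquiv (IsCMField.complexConj L) (Matrix.of fun i j : Fin 3 => if i.val + j.val + 1 = 3 then (1 : L) else 0) (IsCMField.complexConj_ne_one L) w hw ta : ↥(unitaryGroupOfForm (galAdicCompletionMap (L := L) (IsCMField.complexConj L) hw) (placeForm (Matrix.of fun i j : Fin 3 => if i.val + j.val + 1 = 3 then (1 : L) else 0) w.1))) : GL (Fin 3) (w.1.adicCompletion L)) : Matrix (Fin 3) (Fin 3) (w.1.adicCompletion L)) - 1) * ((((localNonsplitEquiv (IsCMField.complexConj L) (Matrix.of fun i j : Fin 3 =>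 if i.val + j.val + 1 = 3 then (1 : L) else 0) (IsCMField.complexConj_ne_one L) w hw ta : ↥(unitaryGroupOfForm (galAdicCompletionMap (L := L) (IsCMField.complexConj L) hw) (placeForm (Matrix.of fun i j : Fin 3 => if i.val + j.val + 1 = 3 then (1 : L) else 0) w.1))) : GL (Fin 3) (w.1.adicCompletion L)) : Matrix (Fin 3) (Fin 3) (w.1.adicCompletion L)) - 1)) M)}.ncard : ℕ) : ℤ)) = (Literature.NumberTheory.QuadraticForms.hilbertSymbol (v.adicCompletion ↥(maximalRealSubfield L)) (β : (v.adicCompletion ↥(maximalRealSubfield L))) (algebraMap ↥(maximalRealSubfield L) _ ((cmQuadraticGenerator L : 𝓞 ↥(maximalRealSubfield L)) : ↥(maximalRealSubfield L))) : ℤ) * ((Fintype.card (Valued.ResidueField (w.1.adicCompletion L))) : ℤ) ^ m *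
      ((((Fintype.card (Valued.ResidueField (w.1.adicCompletion L))) : ℤ) - 1) * (((Nat.card (MulAction.fixedBy (((UnitaryGroup.cmDatum L 2 (Matrix.of fun i j : Fin 2 => if i.val + j.val + 1 = 2 then (1 : L) else 0)).Local v) ⧸ cmLocalIntegralLevel L 2 (Matrix.of fun i j : Fin 2 => if i.val + j.val + 1 = 2 then (1 : L) else 0) v) γH.1)) + d % 2 : ℕ) : ℤ) + 2 - 2 * ((Fintype.card (Valued.ResidueField (w.1.adicCompletion L))) : ℤ) ^ T)) := by
  classical
  have hc1 : IsCMField.complexConj L ≠ 1 := IsCMField.complexConj_ne_one L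
  have hϖ0 : ϖ ≠ 0 := fun h0 => by rw [h0, map_zero] at hϖ; exact WithZero.zero_ne_coe hϖ
  have h20 : (2 : w.1.adicCompletion L) ≠ 0 := two_ne_zero_adicCompletion L v w
  obtain ⟨V₁, hV₁, hV₁all⟩ := exists_nhds_one_le_tokenDepth L v w (3 * d + 3 * tE + 2)
  have hc0 : (ϖ ^ (2 * tE + 2) : w.1.adicCompletion L) ≠ 0 := pow_ne_zero _ hϖ0
  obtain ⟨V₂, hV₂, hV₂all⟩ := exists_nhds_one_block_congr L v w (c := ϖ ^ (2 * tE + 2)) hc0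
  have hc20 : (2 : w.1.adicCompletion L) * ϖ ≠ 0 := mul_ne_zero h20 hϖ0
  have hϖb0 : ϖ ^ (2 * b) ≠ 0 := pow_ne_zero _ hϖ0
  obtain ⟨V₃, hV₃, hV₃all⟩ := ((((eventually_nhds_one_le_tokenDepth L v w (6 * d + 3 * tE + a + b + 2)).and
    (F0P3cDyRamRowOneRootDepth.eventually_nhds_one_valued_trace_sub_two_le L v w hc20)).and
    ((F0P3cDyRamRowOneRootDepth.eventually_nhds_one_valued_trace_sub_two_le L v w hϖb0).and
    (eventually_nhds_one_valued_sub_one_le L v w hϖb0)))).exists_mem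
  refine ⟨V₁ ∩ (V₂ ∩ V₃), Filter.inter_mem hV₁ (Filter.inter_mem hV₂ hV₃), fun γH hγ hreg hirr E' _ _ _ _ c₁ δ m₀ s w₁ hw₁ Θ α lam hc₁1 hc₁δ hδ0 hmδ hs hΔ hDσ htσ hirr'
    hρρ hvρ hρj hjle1 hjfix hΘj hΘΘ hΘρ hvΘ hρα hα1 hint h2lam hlam2 hρlam hΘlam hvlam huniq hαC => ?_⟩
  intro th ta P₁ dg η γ₁ hth hta hform hdg1 hdgσ hησ hη1 hηN hγ₁U hγ₁χ φ h φ' h' hφc hφi hφs hφγ hφH hΘh hh hhyper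
    hφ'c hφ'i hφ's hφ'γ hφ'H hΘh' hh' hjpow hfixpow hsmall J R R' f f' hfinV hRV hfinS hRS hJ hfinLS hfinLS' hu1 hf hf'
  haveI : Finite 𝓀[w₁.1.adicCompletion E'] := finite_residueField_adicCompletion E' w₁.1
  set ρ' : (w₁.1.adicCompletion E') →+* (w₁.1.adicCompletion E') := galAdicCompletionMap (L := E') c₁ hw₁ with hρ'def
  set ιw : (w.1.adicCompletion L) →+* (w₁.1.adicCompletion E') := toPlace w.1 w₁ with hιwdef
  set τ : (w₁.1.adicCompletion E') →+* (w₁.1.adicCompletion E') := Θ.comp ρ' with hτdef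
  have hτ : ∀ x, τ x = Θ (ρ' x) := fun x => rfl
  obtain ⟨ϖM, c₀, n₀, dρ, dΘ, dτ, g, s0, dK, d', hjE2, hqM, hΘres, hτres, hϖM, hαϖM, hDρ, hDΘ, hdτ1, hdτv, hΘc₀, hc₀, hdich, hFNM, hΘn₀, hn₀1, hn₀N,
      hF4τ, hF4, hfS2, hg2, hs02, hg1, hs01, hgs, hdKv, hdK2, hd'v, hd'2⟩ :=
    exists_uniformiser_frame_ramM L w hw E' c₁ w₁ hw₁ hc₁1 he hD ρ' Θ τ hρ'def hτ hρρ hvρ hρα hα1 hint hjle1 hjfix hΘj hΘΘ hΘρ hvΘ hαC hirr' hlam2 hΘlam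
  refine ⟨hFNM, ?_⟩
  intro m β hmtok hβ
  have hm0 : 3 * d + 3 * tE + 2 ≤ m := hV₁all γH (Set.mem_of_mem_inter_left hγ) m hmtok
  obtain ⟨hblock, hublk⟩ := hV₂all γH (Set.mem_of_mem_inter_left (Set.mem_of_mem_inter_right hγ))
  have hdρv : Valued.v (ϖM - ρ' ϖM) = Valued.v ϖM ^ dρ := hDρ.2.2.2.2.1
  set u₀ : (w.1.adicCompletion L) := (((localNonsplitEquiv (IsCMField.complexConj L) (Matrix.of fun i j : Fin 1 => if i.val + j.val + 1 = 1 then (1 : L) else 0)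
      (IsCMField.complexConj_ne_one L) w hw γH.2).val : GL (Fin 1) (w.1.adicCompletion L)) : Matrix (Fin 1) (Fin 1) (w.1.adicCompletion L)) 0 0 with hu₀def
  set qw : ℕ := Nat.card 𝓀[w.1.adicCompletion L] with hqwdef
  have hqw : qw = Fintype.card (Valued.ResidueField (w.1.adicCompletion L)) := Nat.card_eq_fintype_card
  have hΦ1 : IsUnit ((placeForm (Matrix.of fun i j : Fin 1 => if i.val + j.val + 1 = 1 then (1 : L) else 0) w.1) 0 0) := by
    rw [placeForm_antidiagOne]; simp [StdForm.over, StdForm.antidiagonal]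
  have hu₀1 : (galAdicCompletionMap (L := L) (IsCMField.complexConj L) hw) u₀ * u₀ = 1 := mul_map_eq_one_of_mem_unitary_one (galAdicCompletionMap (L := L) (IsCMField.complexConj L) hw) hΦ1
      (localNonsplitEquiv (IsCMField.complexConj L) (Matrix.of fun i j : Fin 1 => if i.val + j.val + 1 = 1 then (1 : L) else 0) (IsCMField.complexConj_ne_one L) w hw γH.2).2
  obtain ⟨hu, hu1'⟩ := map_fixed_and_mul_map_eq_one (galAdicCompletionMap (L := L) (IsCMField.complexConj L) hw) ιw hΘj hjfix hu₀1
  have hϖE : Valued.v (ιw ϖ) = WithZero.exp (-2 : ℤ) := by rw [hjE2, hϖ, ← WithZero.exp_nsmul]; rfl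
  have hϖE0 : ιw ϖ ≠ 0 := fun h0 => by rw [h0, map_zero] at hϖE; exact WithZero.zero_ne_coe hϖE
  have hϖE1 : Valued.v (ιw ϖ) < 1 := by rw [hϖE, ← WithZero.exp_zero, WithZero.exp_lt_exp]; norm_num
  have hρϖ : ρ' (ιw ϖ) = ιw ϖ := hρj ϖ
  have hvαϖ : Valued.v (α - ρ' α) = Valued.v (ϖM - ρ' ϖM) := by rw [hαϖM]
  obtain ⟨jl, hjl⟩ : ∃ jl : ℕ, Valued.v (lam - ρ' lam) = Valued.v (ιw ϖ ^ jl * (ϖM - ρ' ϖM)) := by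
    have hb : lam - ρ' lam = (lam - ρ' lam) / (α - ρ' α) * (α - ρ' α) := (div_mul_cancel₀ _ (sub_ne_zero.2 (Ne.symm hρα))).symm
    have hρb : ρ' ((lam - ρ' lam) / (α - ρ' α)) = (lam - ρ' lam) / (α - ρ' α) := by
      rw [map_div₀, map_sub, map_sub, hρρ, hρρ, ← neg_sub lam, ← neg_sub α, neg_div_neg_eq]
    have hb0 : (lam - ρ' lam) / (α - ρ' α) ≠ 0 := fun h0 => by
      obtain ⟨a, ha⟩ := (hjfix lam).1 (sub_eq_zero.1 (by rw [hb, h0, zero_mul])).symm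
      exact hirr' a ((map_eq_zero_iff ιw (RingHom.injective ιw)).1 (by rw [map_add, map_sub, map_mul, map_mul, ha]; linear_combination hlam2))
    obtain ⟨n, hn⟩ := hfixpow _ hρb hb0 (hint lam hvlam.le)
    exact ⟨n, by rw [hb, map_mul, map_mul, map_pow, hn, hvαϖ]⟩
  have hjlμ : Valued.v ((lam - ιw u₀) - ρ' (lam - ιw u₀)) = Valued.v (ιw ϖ ^ jl * (ϖM - ρ' ϖM)) := by
    rw [ρ'.map_sub, hu, sub_sub_sub_cancel_right, hjl]
  have hmexp : Valued.v (lam - ιw u₀) = WithZero.exp (-(2 * (m : ℤ))) := v_sub_eq_exp_of_token_ramM ιw hjE2 hvρ hjfix hρlam hlam2 u₀ (valued_quadratic_of_mtoken L w hw γH he hmtok)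
  have hjlexp : Valued.v ((lam - ιw u₀) - ρ' (lam - ιw u₀)) = WithZero.exp (-(2 * (jl : ℤ) + dρ)) := by
    rw [hjlμ, map_mul, map_pow, hϖE, hdρv, hϖM, ← WithZero.exp_nsmul, ← WithZero.exp_nsmul, ← WithZero.exp_add]; congr 1; simp only [nsmul_eq_mul]; ring
  obtain ⟨hμ, -⟩ := tokens_pow_of_exp (ρ := ρ') hϖE hDρ hmexp hjlexp
  have hω : Valued.v (ιw (ϖ - (galAdicCompletionMap (L := L) (IsCMField.complexConj L) hw) ϖ)) = WithZero.exp (-(2 * ((g + s0 : ℕ) : ℤ))) := by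
    rw [hjE2, hD.2.2.2.2.1, hϖ, hgs, ← WithZero.exp_nsmul, ← WithZero.exp_nsmul]; congr 1; simp only [nsmul_eq_mul]; ring
  have hρω : ρ' (ιw (ϖ - (galAdicCompletionMap (L := L) (IsCMField.complexConj L) hw) ϖ)) = ιw (ϖ - (galAdicCompletionMap (L := L) (IsCMField.complexConj L) hw) ϖ) := hρj _
  have hΘω : Θ (ιw (ϖ - (galAdicCompletionMap (L := L) (IsCMField.complexConj L) hw) ϖ)) = -ιw (ϖ - (galAdicCompletionMap (L := L) (IsCMField.complexConj L) hw) ϖ) := by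
    rw [hΘj, map_sub, hD.1, ← map_neg, neg_sub]
  have h2M : Valued.v (2 : w₁.1.adicCompletion E') = WithZero.exp (-(2 * (tE : ℤ))) := by
    rw [show (2 : w₁.1.adicCompletion E') = ιw 2 from (map_ofNat ιw 2).symm, hjE2, hD.2.2.2.2.2.2, hϖ, ← WithZero.exp_nsmul, ← WithZero.exp_nsmul]
    congr 1; simp only [nsmul_eq_mul]; ring
  have hΘP : Θ (ϖM * Θ ϖM) = ϖM * Θ ϖM := by rw [map_mul, hΘΘ, mul_comm]
  have hP : Valued.v (ϖM * Θ ϖM) = WithZero.exp (-2 : ℤ) := by rw [map_mul, hvΘ, hϖM, ← WithZero.exp_add]; rfl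
  have hdρle : dρ ≤ 2 * tE + 1 := Literature.NumberTheory.LocalFields.WildQuadraticDatum.d_le_succ_t hDρ.1 hDρ.2.2.2.1 hDρ.2.2.1 hDρ.2.2.2.2.1 hDρ.2.2.2.2.2.2
  obtain ⟨hparW, hmjl⟩ := hparW_of_frame_ramM hρρ hvρ hΘΘ hΘρ hvΘ hF4 hΘP hP hd'v hρω hΘω hg1 hs01 hω h2M
    (by omega : 2 * d' = dρ + 2 * s0) hΘlam hu hu1' hmexp hjlexp (by omega)
  obtain ⟨hreal_on, hreal_off⟩ := realizable_of_frame_ramM hρρ hvρ hΘΘ hΘρ hvΘ hF4 hΘP hP hd'v hρω hΘω hω h2M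
    (by omega : 2 * d' = dρ + 2 * s0) hΘlam hu hu1' hmexp hjlexp (by omega) (by omega)
  have hIsOrd : ∀ (c z : w₁.1.adicCompletion E'), IsOrd ρ' α c z ↔ IsOrd ρ' ϖM c z := fun c z => isOrd_iff_isOrd_of_v_sub_map_eq hvαϖ c z
  have hρϖM : ρ' ϖM ≠ ϖM := fun h0 => by
    have h1 := hdρv; rw [h0, sub_self, map_zero] at h1; exact (pow_ne_zero _ (by rw [hϖM]; exact WithZero.coe_ne_zero)) h1.symm
  have hiff : ∀ j, IsOrd ρ' ϖM (ιw ϖ ^ j) lam ↔ j ≤ jl := fun j =>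
    isOrd_pow_iff_le hρϖM hϖE0 hϖE1 hvlam.le (by rw [hjl, map_mul, map_pow]) j
  have hJle : jl ≤ J := by have h := hJ; rw [hIsOrd, hiff] at h; omega
  have hLS : ∀ (s : w₁.1.adicCompletion E') (j a : ℕ), levelSet ρ' Θ α (ιw ϖ) s j a = levelSet ρ' Θ ϖM (ιw ϖ) s j a :=
    fun s j a => levelSet_eq_of_mul_sub_map_eq (Θ := Θ) hvαϖ (by rw [hαϖM]) _ j a
  have hLSD : ∀ (s μ' : w₁.1.adicCompletion E') (j a : ℕ), levelSetDep ρ' Θ α (ιw ϖ) s j a μ' = levelSetDep ρ' Θ ϖM (ιw ϖ) s j a μ' :=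
    fun s μ' j a => levelSetDep_eq_of_twist (Θ := Θ) (e := 1) (map_one _) (map_one _) (mul_one s).symm (by rw [one_mul]; exact hαϖM) _ j a μ'
  have hRcells : ∀ j b, 1 ≤ b → IsOrd ρ' ϖM (ιw ϖ ^ j) lam → (levelSetDep ρ' Θ ϖM (ιw ϖ) h j b (lam - ιw u₀)).Nonempty → b ≤ R := fun j b hb hjO hne =>
    hRcells_h L w hw hϖ hD h2v ιw hρρ hvρ hjle1 hjfix hΘj hΘΘ hΘρ hvΘ hρα hα1 hint hvlam hth φ hφc hφi hφs hφγ hφH hΘh hh hjpow hsmall hRV hu1 hFNM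
      j b hb ((hIsOrd _ _).2 hjO) (by rwa [hLSD])
  have hRcells' : ∀ j b, 1 ≤ b → IsOrd ρ' ϖM (ιw ϖ ^ j) lam → (levelSetDep ρ' Θ ϖM (ιw ϖ) h' j b (lam - ιw u₀)).Nonempty → b ≤ R' := fun j b hb hjO hne =>
    hRcells_h' L w hw hϖ hD h2v ιw hρρ hvρ hjle1 hjfix hΘj hΘΘ hΘρ hvΘ hρα hα1 hint hvlam hta hform hdg1 hdgσ hησ hη1 φ' hφ'c hφ'i hφ's hφ'γ hφ'H hΘh' hh'
      hjpow hsmall hRS hu1 hFNM j b hb ((hIsOrd _ _).2 hjO) (by rwa [hLSD])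
  obtain ⟨πF, hπF⟩ := v.valuation_exists_uniformizer ↥(maximalRealSubfield L)
  have hϖF : Valued.v ((πF : ↥(maximalRealSubfield L)) : v.adicCompletion ↥(maximalRealSubfield L)) = WithZero.exp (-1 : ℤ) := by
    rw [IsDedekindDomain.HeightOneSpectrum.valuedAdicCompletion_eq_valuation', hπF]
  haveI : Finite (IsLocalRing.ResidueField 𝒪[v.adicCompletion ↥(maximalRealSubfield L)]) := finite_residueField_adicCompletion _ v
  have htube := v_disc_lt_tube (ϖ := ϖ) (v_pow_lt_v_two hϖ hD.2.2.2.2.2.2 (N := 2 * tE + 2) (by omega))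
    (v_pow_sq_lt_tube hϖ hD.2.2.2.2.2.2 (N := 2 * tE + 2) le_rfl) hblock
  obtain ⟨hjlg, hH⟩ := hSide_closedForm_ramM_hLevel L v w hw hϖF he hD γH.1 hirr htube E' c₁ hc₁1 w₁ hw₁ Θ hjle1 hjfix hΘj hΘΘ hΘρ hvΘ
    hρα hα1 hint hlam2 hρlam hΘlam hvlam hαC hDρ hDΘ hjl hg2
  have hreg : (m + s0 ≤ jl ∧ (m + s0) % 2 = jl % 2) ∨ jl + 1 = m + s0 := (em (m % 2 = (g + s0) % 2)).elim (fun hpar => Or.inl ⟨hreal_on hpar, by omega⟩) fun hpar => Or.inr (hreal_off hpar)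
  set ε : ℤ := hilbertSymbol (v.adicCompletion ↥(maximalRealSubfield L)) (β : (v.adicCompletion ↥(maximalRealSubfield L)))
      (algebraMap ↥(maximalRealSubfield L) _ ((cmQuadraticGenerator L : 𝓞 ↥(maximalRealSubfield L)) : ↥(maximalRealSubfield L))) with hεdef
  have hε : ε = 1 ∨ ε = -1 := hilbertSymbol_eq_one_or_eq_neg_one _ _
  have hds : 2 * d' = dρ + 2 * s0 := by omega
  obtain ⟨eh, heh⟩ := F0P3cDyRamTokenRealizabilityRamM.exists_v_eq_exp hh
  obtain ⟨eh', heh'⟩ := F0P3cDyRamTokenRealizabilityRamM.exists_v_eq_exp hh'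
  have hvh : Valued.v h = WithZero.exp (-(-eh)) := by rw [neg_neg]; exact heh
  have hvh' : Valued.v h' = WithZero.exp (-(-eh')) := by rw [neg_neg]; exact heh'
  have hplane : ¬ ∃ x : Fin 2 → (w.1.adicCompletion L), x ≠ 0 ∧
      pairing (galAdicCompletionMap (L := L) (IsCMField.complexConj L) hw) (Matrix.diagonal dg) x x = 0 :=
    not_exists_pairing_diagonal_self_eq_zero_of_formCongr (galAdicCompletionMap (L := L) (IsCMField.complexConj L) hw) P₁ dg η
      (by rw [← placeForm_antidiagOne]; exact hform) hdgσ
      (fun i h0 => by have h1 := hdg1 i; rw [h0, map_zero] at h1; exact zero_ne_one h1) hηN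
  have haniso : ¬ ∃ z : (w₁.1.adicCompletion E'), z ≠ 0 ∧ h' * Θ z * z + ρ' (h' * Θ z * z) = 0 :=
    not_exists_herm_self_eq_zero_of_lineModel (galAdicCompletionMap (L := L) (IsCMField.complexConj L) hw) (Matrix.diagonal dg) ιw φ' hφ's hφ'H hplane
  obtain ⟨ecl, he_cls⟩ : ∃ e : ℤ, -eh + dρ = 2 * e := F0P3cDyRamClassLettersRamM.exists_half_order_add hDΘ.2.2.2.1 hΘh hh hvh hds
  obtain ⟨ecl', he_cls'⟩ : ∃ e : ℤ, -eh' + dρ = 2 * e := F0P3cDyRamClassLettersRamM.exists_half_order_add hDΘ.2.2.2.1 hΘh' hh' hvh' hds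
  have hq2dvd : 2 ∣ qw := two_dvd_natCard_residueField_of_v_two_lt_one h2v hqwdef.symm
  obtain ⟨K', instF', instV', σ', π', jK, instDVR', instFin', -, instCS', hσ', hvσ', hfix', hπ', hdd', hjle, hjΘ, hjfixΘ, hjσ, hjπ, -⟩ :=
    exists_thirdFieldPackage_ramM hρρ hvρ hΘρ hDΘ hΘres hF4 hd'v
  have hDτ : IsRamifiedQuadraticDatum τ ϖM dτ (2 * tE) := isRamifiedQuadraticDatum_tau hDρ hΘΘ hΘρ hvΘ hτ hfix' hπ' jK hjle hjfixΘ hjσ hjπ hdτv hdτ1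
  have hlamΘ : lam * Θ lam = 1 := by rw [mul_comm]; exact hΘlam
  have hχ : ((finCharpolyTwo L v γH).eval (finGammaTwo L v γH)) w =
      u₀ ^ 2 - (((γH.1.val : GL (Fin 2) (UnitaryGroup.LocalRing L v)).val.map (Pi.evalRingHom (fun w' : UnitaryGroup.PlacesOver L v => w'.1.adicCompletion L) w))).trace * u₀ +
        (((γH.1.val : GL (Fin 2) (UnitaryGroup.LocalRing L v)).val.map
          (Pi.evalRingHom (fun w' : UnitaryGroup.PlacesOver L v => w'.1.adicCompletion L) w))).det := eval_finCharpolyTwo_finGammaTwo_apply_eq_quadratic L v w γH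
  obtain ⟨ν₀, sθ, hν₀D, hσν₀, hsθ0, hσsθ, hρν, hνΘ, hdetν, hρsθ, hΘsθ, hjsθ0, hjν0, hlamν1, h1lam, h1u, hlamu, hS3b⟩ :=
    F0P3cDyRamSignSymbolRamM.hilbertSymbol_eq_one_iff_exists_rhoNorm_signKappa_ramM L w hw ϖ d tE hD h2v ιw hjE2 ρ' Θ hρρ hvρ hΘρ hΘΘ hvΘ hjfix hΘj
      hΘlam hlam2 hρlam hirr' hDσ hu₀1 hmexp (by omega) (β : v.adicCompletion ↥(maximalRealSubfield L)) hχ hβ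
  obtain ⟨hT, hE, hP, hM, -⟩ := F0P3cDyRamSignLawRamM.sign_law_ramM hρρ hvρ hΘΘ hΘρ hvΘ hF4 hσ' hvσ' hfix' hπ' hdd' jK hjle hjΘ hjfixΘ hjσ hjπ hDΘ hFNM
    hΘn₀ hn₀1 hn₀N hc₀ hdich hfS2 hϖM hg2 hds hg1 hlamΘ hu hu1' hρν hνΘ hdetν hρsθ hΘsθ hjsθ0
    (hlamν1.trans (by rw [WithZero.exp_le_exp]; omega)) h1lam h1u hlamu hmexp hjlexp hΘh hh hhyper hΘh' hh' haniso
    ((m : ℤ) - jl - ecl) ((m : ℤ) - jl - ecl')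
  have hST : m + s0 ≤ jl → (∃ ω : w₁.1.adicCompletion E', Valued.v ω = 1 ∧
      Valued.v (ρ' (lam - ιw u₀) / (lam - ιw u₀) * (ρ' (ω * Θ ω) / (ω * Θ ω)) - 1) ≤ WithZero.exp (-(2 * ((s0 : ℤ) + 2 * g - 1) + dρ))) → (ε : ℚ) = 1 := fun _ hx => by
    have h1 : ε = 1 := by rw [hεdef]; exact hS3b.2 (hT hx)
    rw [h1]; norm_num
  have hSE : m + s0 ≤ jl → (∃ ω : w₁.1.adicCompletion E', Valued.v ω = 1 ∧
      Valued.v (ρ' (lam - ιw u₀) / (lam - ιw u₀) * (ρ' n₀ / n₀) * (ρ' (ω * Θ ω) / (ω * Θ ω)) - 1) ≤ WithZero.exp (-(2 * ((s0 : ℤ) + 2 * g - 1) + dρ))) → (ε : ℚ) = -1 := fun _ hx => by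
    rcases hε with h1 | h1
    · exact absurd (hS3b.1 (by rw [hεdef] at h1; exact h1)) (hE hx)
    · rw [h1]; norm_num
  have hSP : jl + 1 = m + s0 → (∃ ω₁ : (w₁.1.adicCompletion E')ˣ, Valued.v (ω₁ : w₁.1.adicCompletion E') = 1 ∧
      Valued.v (1 + ρ' h / h * (ρ' (ϖM ^ ((m : ℤ) - jl - ecl) * Θ (ϖM ^ ((m : ℤ) - jl - ecl))) / (ϖM ^ ((m : ℤ) - jl - ecl) * Θ (ϖM ^ ((m : ℤ) - jl - ecl)))) /
        (ρ' (lam - ιw u₀) / (lam - ιw u₀)) * (ρ' ((ω₁ : w₁.1.adicCompletion E') * Θ ω₁) / ((ω₁ : w₁.1.adicCompletion E') * Θ ω₁))) ≤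
          WithZero.exp (-(2 * ((s0 : ℤ) + 2 * g - 1) + dρ))) → (ε : ℚ) = 1 := fun _ hx => by
    have h1 : ε = 1 := by rw [hεdef]; exact hS3b.2 (hP hx)
    rw [h1]; norm_num
  have hSM : jl + 1 = m + s0 → (∃ ω₁ : (w₁.1.adicCompletion E')ˣ, Valued.v (ω₁ : w₁.1.adicCompletion E') = 1 ∧
      Valued.v (1 + ρ' h' / h' * (ρ' (ϖM ^ ((m : ℤ) - jl - ecl') * Θ (ϖM ^ ((m : ℤ) - jl - ecl'))) / (ϖM ^ ((m : ℤ) - jl - ecl') * Θ (ϖM ^ ((m : ℤ) - jl - ecl')))) /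
        (ρ' (lam - ιw u₀) / (lam - ιw u₀)) * (ρ' ((ω₁ : w₁.1.adicCompletion E') * Θ ω₁) / ((ω₁ : w₁.1.adicCompletion E') * Θ ω₁))) ≤
          WithZero.exp (-(2 * ((s0 : ℤ) + 2 * g - 1) + dρ))) → (ε : ℚ) = -1 := fun _ hx => by
    rcases hε with h1 | h1
    · exact absurd (hS3b.1 (by rw [hεdef] at h1; exact h1)) (hM hx)
    · rw [h1]; norm_num
  have hεQ : (ε : ℚ) = 1 ∨ ((ε : ℚ) = -1 ∧ jl + 2 ≤ m + 2 * g + s0) := by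
    rcases hε with h1 | h1
    · exact Or.inl (by rw [h1, Int.cast_one])
    by_cases hwin : jl + 2 ≤ m + 2 * g + s0
    · exact Or.inr ⟨by rw [h1, Int.cast_neg, Int.cast_one], hwin⟩
    refine Or.inl (hST (by omega) ⟨1, map_one _, ?_⟩)
    have hμ0 : lam - ιw u₀ ≠ 0 := fun h0 => by rw [h0, map_zero] at hmexp; exact WithZero.zero_ne_coe hmexp
    rw [map_one, mul_one, map_one, div_one, mul_one, div_sub_one hμ0, map_div₀, Valuation.map_sub_swap, hjlexp, hmexp, ← WithZero.exp_sub]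
    exact WithZero.exp_le_exp.2 (by omega)
  obtain ⟨⟨hVm, -⟩, hVtr2, hVu1, hVdet⟩ := hV₃all γH (Set.mem_of_mem_inter_right (Set.mem_of_mem_inter_right hγ))
  have hm0' : 6 * d + 3 * tE + a + b + 2 ≤ m := hVm m hmtok
  have hq1 : 1 ≤ qw := by rw [hqw]; exact Fintype.card_pos
  have hq2 : 2 ≤ qw := by have h1 : 1 < Nat.card 𝓀[w.1.adicCompletion L] := Finite.one_lt_card; rw [← hqwdef] at h1; omega
  have hu₀γ : u₀ = finGammaTwo L v γH w := rfl
  have ham : a ≤ m := by omega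
  have hbm : b ≤ m := by omega
  have hab : a ≤ b := by omega
  have hvϖ2b : Valued.v (ϖ ^ (2 * b)) = Valued.v ϖ ^ (2 * b) := map_pow _ _ _
  have hu1le : Valued.v (u₀ - 1) ≤ Valued.v ϖ ^ (2 * b) := by rw [hu₀γ, ← hvϖ2b]; exact hVu1
  have hdetle := hVdet; rw [hvϖ2b] at hdetle
  have htrle := hVtr2; rw [hvϖ2b] at htrle
  have hjlv : Valued.v (lam - ρ' lam) = Valued.v (ιw ϖ) ^ jl * Valued.v (α - ρ' α) := by rw [hjl, map_mul, map_pow, hvαϖ]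
  obtain ⟨kν, hkνb, hkν, hm₁, hμ₂v, hlev, hlev2, hdeepT, huc, huc2⟩ := levelTokens_near_one_ramM ιw hvρ hjE2 hρj hϖ hρlam hlam2 hρα hjlv hμ hab ham hbm hdetle htrle hu1le
  have hajl : a ≤ jl := by omega
  have hρϖa : ρ' (ιw ϖ ^ a) = ιw ϖ ^ a := by rw [map_pow, hρϖ]
  have htea : Valued.v (ιw ϖ ^ a) = Valued.v (ιw ϖ) ^ a := map_pow _ _ _
  have hΓ := (localNonsplitEquiv (IsCMField.complexConj L) (Matrix.of fun i j : Fin 3 => if i.val + j.val + 1 = 3 then (1 : L) else 0)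
    (IsCMField.complexConj_ne_one L) w hw th).2
  rw [hth] at hΓ
  have hmem := (localNonsplitEquiv (IsCMField.complexConj L) (Matrix.of fun i j : Fin 3 => if i.val + j.val + 1 = 3 then (1 : L) else 0)
    (IsCMField.complexConj_ne_one L) w hw ta).2
  rw [hta] at hmem
  have hσ : ∀ x, (galAdicCompletionMap (L := L) (IsCMField.complexConj L) hw) ((galAdicCompletionMap (L := L) (IsCMField.complexConj L) hw) x) = x := galAdicCompletionMap_involutive L v w hw
  have hvσ : ∀ x, Valued.v ((galAdicCompletionMap (L := L) (IsCMField.complexConj L) hw) x) = Valued.v x := fun x => valued_galAdicCompletionMap (L := L) (IsCMField.complexConj L) hw x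
  have hH₂σ : ((placeForm (Matrix.of fun i j : Fin 2 => if i.val + j.val + 1 = 2 then (1 : L) else 0) w.1).map (galAdicCompletionMap (L := L) (IsCMField.complexConj L) hw))ᵀ = placeForm (Matrix.of fun i j : Fin 2 => if i.val + j.val + 1 = 2 then (1 : L) else 0) w.1 :=
    placeForm_map_transpose_of_hermitian L v w hw _ (antidiagOne_isHermitian L 2)
  have hDgσ : ((Matrix.diagonal dg).map (galAdicCompletionMap (L := L) (IsCMField.complexConj L) hw))ᵀ = Matrix.diagonal dg := by
    rw [Matrix.diagonal_map (map_zero _), Matrix.diagonal_transpose]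
    exact congrArg Matrix.diagonal (funext hdgσ)
  obtain ⟨z, ξ, hz1, hzξ, hσξ, hξN⟩ := exists_flipUnit_of_forall_fixed_fixed_isNorm (galAdicCompletionMap (L := L) (IsCMField.complexConj L) hw) hD ιw hvΘ hΘj hjfix hjpow hFNM
  have hca0 : ϖ ^ a ≠ 0 := pow_ne_zero _ hϖ0
  have hca1 : Valued.v (ϖ ^ a) ≤ 1 := by rw [map_pow]; exact pow_le_one₀ zero_le (le_of_lt (by rw [hϖ, ← WithZero.exp_zero, WithZero.exp_lt_exp]; norm_num))
  obtain ⟨C, hCdef⟩ : ∃ C : ℕ, C = m + jl - b := ⟨_, rfl⟩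
  have hwP : ∀ b' ∈ Finset.Icc 1 R, ∀ j ∈ Finset.range (jl - a + 1), (if j + b' ≤ C then ∑ᶠ Λ ∈ levelSetDep ρ' Θ α (ιw ϖ) h j b' ((ιw ϖ ^ a)⁻¹ * (lam - ιw u₀)), f b' j Λ else 0) = (if j + b' ≤ C then qw ^ b' * (levelSetDep ρ' Θ α (ιw ϖ) h j b' ((ιw ϖ ^ a)⁻¹ * (lam - ιw u₀))).ncard else 0) := by
    intro b' hb' j hj
    rw [Finset.mem_range] at hj
    by_cases hc : j + b' ≤ C
    · rw [if_pos hc, if_pos hc]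
      have hw := finsum_levelSetDep_weight_eq_pow_mul_ncard_inv_mul (galAdicCompletionMap (L := L) (IsCMField.complexConj L) hw) hσ hvσ hϖ hD h2v hH₂σ (hW := (1 : (w.1.adicCompletion L))) (by rw [map_one]) (map_one _) ιw hρρ hvρ hρα hα1 hint hΘΘ hΘρ hvΘ hΘj hjle1 hjfix hjpow hsmall φ hφc hφi hφs hφγ hvlam hΘh hh hφH z hz1 ξ hzξ hσξ hξN
        u₀ hca0 hca1 (Finset.mem_Icc.1 hb').1 ((hIsOrd _ _).2 ((hiff j).2 (by omega))) (hfinLS j b') f hf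
      rw [map_pow] at hw; rw [hw, hqwdef]
    · rw [if_neg hc, if_neg hc]
  have hwM : ∀ b' ∈ Finset.Icc 1 R', ∀ j ∈ Finset.range (jl - a + 1), (if j + b' ≤ C then ∑ᶠ Λ ∈ levelSetDep ρ' Θ α (ιw ϖ) h' j b' ((ιw ϖ ^ a)⁻¹ * (lam - ιw u₀)), f' b' j Λ else 0) = (if j + b' ≤ C then qw ^ b' * (levelSetDep ρ' Θ α (ιw ϖ) h' j b' ((ιw ϖ ^ a)⁻¹ * (lam - ιw u₀))).ncard else 0) := by
    intro b' hb' j hj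
    rw [Finset.mem_range] at hj
    by_cases hc : j + b' ≤ C
    · rw [if_pos hc, if_pos hc]
      have hw := finsum_levelSetDep_weight_eq_pow_mul_ncard_inv_mul (galAdicCompletionMap (L := L) (IsCMField.complexConj L) hw) hσ hvσ hϖ hD h2v hDgσ hη1 hησ ιw hρρ hvρ hρα hα1 hint hΘΘ hΘρ hvΘ hΘj hjle1 hjfix hjpow hsmall φ' hφ'c hφ'i hφ's hφ'γ hvlam hΘh' hh' hφ'H z hz1 ξ hzξ hσξ hξN
        u₀ hca0 hca1 (Finset.mem_Icc.1 hb').1 ((hIsOrd _ _).2 ((hiff j).2 (by omega))) (hfinLS' j b') f' hf'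
      rw [map_pow] at hw; rw [hw, hqwdef]
    · rw [if_neg hc, if_neg hc]
  have hκ : ∀ j, IsOrd ρ' ϖM (ιw ϖ ^ j) (ιw ϖ ^ a) := fun j =>
    isOrd_of_map_eq_self hρϖa (by rw [htea]; exact pow_le_one₀ zero_le hϖE1.le) _
  have hμfac : lam - ιw u₀ = ιw ϖ ^ a * ((ιw ϖ ^ a)⁻¹ * (lam - ιw u₀)) := by
    rw [mul_inv_cancel_left₀ (pow_ne_zero _ hϖE0)]
  have hme : m - a + a = m := by omega
  have hjle : jl - a + a = jl := by omega
  obtain ⟨hμ₁', hjl₁', -⟩ := tokens_inv_mul (ρ := ρ') hϖE hμ hjlμ hρϖa htea hme hjle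
  have hiff₁ : ∀ j, IsOrd ρ' ϖM (ιw ϖ ^ j) ((ιw ϖ ^ a)⁻¹ * (lam - ιw u₀)) ↔ j ≤ jl - a := fun j =>
    isOrd_pow_iff_le_ramified hDρ hϖE (by rw [hμ₁']; exact pow_le_one₀ zero_le hϖE1.le) hjl₁' j
  have hRh : ∀ j b', 1 ≤ b' → IsOrd ρ' ϖM (ιw ϖ ^ j) ((ιw ϖ ^ a)⁻¹ * (lam - ιw u₀)) → (levelSetDep ρ' Θ ϖM (ιw ϖ) h j b' ((ιw ϖ ^ a)⁻¹ * (lam - ιw u₀))).Nonempty → b' ≤ R :=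
    fun j b' hb' hj hne => hRcells j b' hb' ((hiff j).2 (by have := (hiff₁ j).1 hj; omega)) (hne.mono (levelSetDep_subset_of_eq_mul hvρ (hκ j) hμfac))
  have hRh' : ∀ j b', 1 ≤ b' → IsOrd ρ' ϖM (ιw ϖ ^ j) ((ιw ϖ ^ a)⁻¹ * (lam - ιw u₀)) → (levelSetDep ρ' Θ ϖM (ιw ϖ) h' j b' ((ιw ϖ ^ a)⁻¹ * (lam - ιw u₀))).Nonempty → b' ≤ R' :=
    fun j b' hb' hj hne => hRcells' j b' hb' ((hiff j).2 (by have := (hiff₁ j).1 hj; omega)) (hne.mono (levelSetDep_subset_of_eq_mul hvρ (hκ j) hμfac))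
  have hjlbig : b + 2 * d ≤ jl := by omega
  have hdjl : d + a ≤ jl := by omega
  have hx : (qw : ℚ) ≠ 1 := by exact_mod_cast (show qw ≠ 1 by omega)
  have hxF : ((Fintype.card (Valued.ResidueField (w.1.adicCompletion L)) : ℕ) : ℚ) ≠ 1 := by rw [← hqw]; exact hx
  have hq1F : 1 ≤ Fintype.card (Valued.ResidueField (w.1.adicCompletion L)) := Fintype.card_pos
  have hC1 : jl - a ≤ C := by rw [hCdef]; omega
  have hCe : C + (g + s0) ≤ m - a + (jl - a) + 1 := by rw [hCdef]; omega
  have had' : a ≤ g + s0 := by omega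
  rcases Nat.even_or_odd' kν with ⟨k2, hk | hk⟩
  ·
    have hm₂ : Valued.v ((ιw ϖ ^ b)⁻¹ * ((lam - 1) * (lam - 1) - ιw ((u₀ - 1) ^ 2))) = Valued.v (ιw ϖ) ^ (m - b + k2) := by
      rw [hμ₂v, hk, pow_add]; congr 1; rw [hϖE, ← WithZero.exp_nsmul]; congr 1; push_cast; ring
    have hle : m - a ≤ m - b + k2 := by omega
    have hk2le : k2 ≤ jl := by
      have hν2 : Valued.v (lam + ιw u₀ - 2) = Valued.v (ιw ϖ ^ k2) := by
        rw [map_pow, hkν, hk, hϖE, ← WithZero.exp_nsmul]; congr 1; push_cast; ring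
      have hk0 : ιw ϖ ^ k2 ≠ 0 := pow_ne_zero _ hϖE0
      have hz1 : Valued.v ((ιw ϖ ^ k2)⁻¹ * (lam + ιw u₀ - 2)) ≤ 1 := by
        rw [map_mul, map_inv₀, hν2, inv_mul_cancel₀ ((Valuation.ne_zero_iff _).2 hk0)]
      have hI := hint _ hz1
      have hρk : ρ' ((ιw ϖ ^ k2)⁻¹) = (ιw ϖ ^ k2)⁻¹ := by rw [map_inv₀, map_pow, hρϖ]
      have h1 : (ιw ϖ ^ k2)⁻¹ * (lam + ιw u₀ - 2) - ρ' ((ιw ϖ ^ k2)⁻¹ * (lam + ιw u₀ - 2)) = (ιw ϖ ^ k2)⁻¹ * ((lam - ιw u₀) - ρ' (lam - ιw u₀)) := by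
        simp only [map_mul, map_sub, map_add, hρk, hu, map_ofNat]; ring
      rw [h1, map_div₀, map_mul, map_inv₀, map_pow, hjlexp, hvαϖ, hdρv, hϖM, hϖE, ← WithZero.exp_nsmul, ← WithZero.exp_nsmul, inv_mul_eq_div,
        ← WithZero.exp_sub, ← WithZero.exp_sub, ← WithZero.exp_zero, WithZero.exp_le_exp] at hI
      simp only [nsmul_eq_mul] at hI
      omega
    have hgd : ∀ j b', (j + b' ≤ m - b + k2 ∨ 2 * (j + b') + kν ≤ 2 * (m - b + k2) + 2 * jl) ↔ j + b' ≤ C := fun j b' => guard_even_iff_cutoff hk hCdef hbm hk2le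
    have hcntP := ncard_typeZero_fixed_endoGL_levels_eq_cutoff_ramM_atUnif L w hw hϖ ιw hρρ hvρ hρα hα1 hint hΘΘ hΘρ hvΘ hΘj hjle1 hjfix hjpow hfixpow hsmall
      φ hφc hφi hφs _ hφγ hvlam hΘh hh hφH _ hΓ hu1 a b huc huc2 hfinV hRV hJ hfinLS f hf hDρ hαϖM hϖE hm₁ hm₂ hle hjlv hlev hajl hlev2 hdeepT hkν
    have hcntM := ncard_typeZero_fixed_conj_endoGL_levels_eq_cutoff_ramM_atUnif L w hw hϖ ιw hρρ hvρ hρα hα1 hint hΘΘ hΘρ hvΘ hΘj hjle1 hjfix hjpow hfixpow hsmall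
      P₁ dg η γ₁ _ hform hdg1 hdgσ hησ hη1 hmem hu1 a b huc huc2 φ' hφ'c hφ'i hφ's hφ'γ hvlam hΘh' hh' hφ'H hfinS hRS hJ hfinLS' f' hf' hDρ hαϖM hϖE hm₁ hm₂ hle hjlv hlev hajl hlev2 hdeepT hkν
    have hgdP : ∀ b' ∈ Finset.Icc 1 R, ∀ j ∈ Finset.range (jl - a + 1), (if (j + b' ≤ m - b + k2 ∨ 2 * (j + b') + kν ≤ 2 * (m - b + k2) + 2 * jl) then ∑ᶠ Λ ∈ levelSetDep ρ' Θ α (ιw ϖ) h j b' ((ιw ϖ ^ a)⁻¹ * (lam - ιw u₀)), f b' j Λ else 0) = (if j + b' ≤ C then qw ^ b' * (levelSetDep ρ' Θ α (ιw ϖ) h j b' ((ιw ϖ ^ a)⁻¹ * (lam - ιw u₀))).ncard else 0) :=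
      fun b' hb' j hj => by rw [if_congr (hgd j b') rfl rfl]; exact hwP b' hb' j hj
    have hgdM : ∀ b' ∈ Finset.Icc 1 R', ∀ j ∈ Finset.range (jl - a + 1), (if (j + b' ≤ m - b + k2 ∨ 2 * (j + b') + kν ≤ 2 * (m - b + k2) + 2 * jl) then ∑ᶠ Λ ∈ levelSetDep ρ' Θ α (ιw ϖ) h' j b' ((ιw ϖ ^ a)⁻¹ * (lam - ιw u₀)), f' b' j Λ else 0) = (if j + b' ≤ C then qw ^ b' * (levelSetDep ρ' Θ α (ιw ϖ) h' j b' ((ιw ϖ ^ a)⁻¹ * (lam - ιw u₀))).ncard else 0) :=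
      fun b' hb' j hj => by rw [if_congr (hgd j b') rfl rfl]; exact hwM b' hb' j hj
    rw [Finset.sum_congr rfl fun b' hb' => Finset.sum_congr rfl fun j hj => hgdP b' hb' j hj] at hcntP
    rw [Finset.sum_congr rfl fun b' hb' => Finset.sum_congr rfl fun j hj => hgdM b' hb' j hj] at hcntM
    clear hgdP hgdM
    rw [hth, hta, hcntP, hcntM, hqw]
    clear hcntP hcntM hwP hwM
    simp only [hLS, hLSD]
    rcases Nat.mod_two_eq_zero_or_one a with ha2 | ha2
    ·
      have hweld := levelOrderCounts_ramM_weld_cut_of_frame hρρ hvρ hΘΘ hΘρ hvΘ hτ hΘres hϖM hDρ hDΘ hDτ hF4 hFNM hc₀ hdich hΘn₀ hn₀1 hn₀N hϖE hρϖ hqM hq2dvd hg2 hs02 hg1 hs01 hdKv hdK2 hd'v hd'2 hΘh hh hhyper hΘh' hh' haniso hvh hvh' he_cls he_cls' hlamΘ hu hu1' hμ hjlμ hρϖa htea ha2 hme hjle hjlg hmjl (by omega) hparW hreg (ε : ℚ) hεQ hST hSE hSP hSM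
        had' (by omega) C hC1 hCe hiff₁ hRh hRh'
      rw [hqw] at hweld
      exact levels_bottom_arith hε hweld (law_ramM_std _ hxF hgs hjlg hreg hmjl hab1 hbm hg1 hs01 hCdef rfl ha2 hks hT0 hdjl hjlbig) hH hq1F
    ·
      have hweld := levelOrderCounts_ramM_weld_cut_of_frame_flip hρρ hvρ hΘΘ hΘρ hvΘ hτ hΘres hϖM hDρ hDΘ hDτ hF4 hFNM hc₀ hdich hΘn₀ hn₀1 hn₀N hϖE hρϖ hqM hq2dvd hg2 hs02 hg1 hs01 hdKv hdK2 hd'v hd'2 hΘh hh hhyper hΘh' hh' haniso hvh hvh' he_cls he_cls' hlamΘ hu hu1' hμ hjlμ hρϖa htea ha2 hme hjle hjlg hmjl (by omega) hparW hreg (ε : ℚ) hεQ hST hSE hSP hSM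
        had' (by omega) C hC1 hCe hiff₁ hRh hRh'
      rw [hqw] at hweld
      exact levels_bottom_arith hε hweld (law_ramM_flip _ hxF hgs hjlg hreg hmjl hab1 hbm hg1 hs01 hCdef rfl ha2 hks hT1 hdjl hjlbig) hH hq1F
  ·
    have hν : Valued.v (lam + ιw u₀ - 2) = WithZero.exp (-(2 * (k2 : ℤ) + 1)) := by rw [hkν, hk]; push_cast; ring_nf
    have hνρ := v_sub_map_eq_of_v_odd_ramified hDρ hρϖ hϖE hν
    have hk2 : k2 = jl := by
      have h1 : lam + ιw u₀ - 2 - ρ' (lam + ιw u₀ - 2) = (lam - ιw u₀) - ρ' (lam - ιw u₀) := by simp only [map_sub, map_add, hu, map_ofNat]; ring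
      rw [h1, hjlexp] at hνρ
      have h2 := WithZero.exp_injective hνρ
      omega
    have hm₂ : Valued.v ((ιw ϖ ^ b)⁻¹ * ((lam - 1) * (lam - 1) - ιw ((u₀ - 1) ^ 2))) = Valued.v (ιw ϖ) ^ C * Valued.v ϖM := by
      rw [hμ₂v, hϖE, hϖM, ← WithZero.exp_nsmul, ← WithZero.exp_nsmul, ← WithZero.exp_add, ← WithZero.exp_add]
      congr 1; simp only [nsmul_eq_mul]; rw [hk, hk2, hCdef]; push_cast; omega
    have hcntP := ncard_typeZero_fixed_endoGL_levels_eq_cutoff_ramM_odd_atUnif L w hw hϖ ιw hρρ hvρ hρα hα1 hint hΘΘ hΘρ hvΘ hΘj hjle1 hjfix hjpow hfixpow hsmall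
      φ hφc hφi hφs _ hφγ hvlam hΘh hh hφH _ hΓ hu1 a b huc huc2 hfinV hRV hJ hfinLS f hf hDρ hαϖM hϖE hm₂ hjlv hlev hajl hlev2 hdeepT
    have hcntM := ncard_typeZero_fixed_conj_endoGL_levels_eq_cutoff_ramM_odd_atUnif L w hw hϖ ιw hρρ hvρ hρα hα1 hint hΘΘ hΘρ hvΘ hΘj hjle1 hjfix hjpow hfixpow hsmall
      P₁ dg η γ₁ _ hform hdg1 hdgσ hησ hη1 hmem hu1 a b huc huc2 φ' hφ'c hφ'i hφ's hφ'γ hvlam hΘh' hh' hφ'H hfinS hRS hJ hfinLS' f' hf' hDρ hαϖM hϖE hm₂ hjlv hlev hajl hlev2 hdeepT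
    rw [Finset.sum_congr rfl fun b' hb' => Finset.sum_congr rfl fun j hj => hwP b' hb' j hj] at hcntP
    rw [Finset.sum_congr rfl fun b' hb' => Finset.sum_congr rfl fun j hj => hwM b' hb' j hj] at hcntM
    rw [hth, hta, hcntP, hcntM, hqw]
    clear hcntP hcntM hwP hwM
    simp only [hLS, hLSD]
    rcases Nat.mod_two_eq_zero_or_one a with ha2 | ha2
    ·
      have hweld := levelOrderCounts_ramM_weld_cut_of_frame hρρ hvρ hΘΘ hΘρ hvΘ hτ hΘres hϖM hDρ hDΘ hDτ hF4 hFNM hc₀ hdich hΘn₀ hn₀1 hn₀N hϖE hρϖ hqM hq2dvd hg2 hs02 hg1 hs01 hdKv hdK2 hd'v hd'2 hΘh hh hhyper hΘh' hh' haniso hvh hvh' he_cls he_cls' hlamΘ hu hu1' hμ hjlμ hρϖa htea ha2 hme hjle hjlg hmjl (by omega) hparW hreg (ε : ℚ) hεQ hST hSE hSP hSM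
        had' (by omega) C hC1 hCe hiff₁ hRh hRh'
      rw [hqw] at hweld
      exact levels_bottom_arith hε hweld (law_ramM_std _ hxF hgs hjlg hreg hmjl hab1 hbm hg1 hs01 hCdef rfl ha2 hks hT0 hdjl hjlbig) hH hq1F
    ·
      have hweld := levelOrderCounts_ramM_weld_cut_of_frame_flip hρρ hvρ hΘΘ hΘρ hvΘ hτ hΘres hϖM hDρ hDΘ hDτ hF4 hFNM hc₀ hdich hΘn₀ hn₀1 hn₀N hϖE hρϖ hqM hq2dvd hg2 hs02 hg1 hs01 hdKv hdK2 hd'v hd'2 hΘh hh hhyper hΘh' hh' haniso hvh hvh' he_cls he_cls' hlamΘ hu hu1' hμ hjlμ hρϖa htea ha2 hme hjle hjlg hmjl (by omega) hparW hreg (ε : ℚ) hεQ hST hSE hSP hSM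
        had' (by omega) C hC1 hCe hiff₁ hRh hRh'
      rw [hqw] at hweld
      exact levels_bottom_arith hε hweld (law_ramM_flip _ hxF hgs hjlg hreg hmjl hab1 hbm hg1 hs01 hCdef rfl ha2 hks hT1 hdjl hjlbig) hH hq1F

end Summit.HodgeConjecture.HodgeConjecture.Cruxes.H413.F0P3cDyRamLevelsCensusRamM

end
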